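import Mathlib
import HarnessLib
import Summits.Ventures.LatticeQCDFlow.Exactness.SUNExpDriftWork

/-!
# `SU(N)` rung in general coordinates — THE ENERGY ERROR OF ONE STEP OF THE ENGINE'S OMF2 INTEGRATOR (`K(λ) D(½) K(1−2λ) D(½) K(λ)` with the drift `e_δ` and the consistent kicks) IS SECOND ORDER, WITH EXPLICIT CONSTANTS — the energy identity and the bound, for ANY action and ANY bounded pairing

HONEST FRAMING: exact (Metropolis-corrected) sampling algorithms for lattice gauge theory;
figures of merit are autocorrelation/cost numbers at stated couplings and volumes; no
continuum-physics claim.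

Venture `LatticeQCDFlow` (cell pub-lqcd), topic `Exactness`; FANOUT row 14 (`eng-flowhmc`, engine
`latflow.fthmc`, family B, `dynamics.Dynamics(integrator = "omf2")`: the word `omf2Word g₁ (mulDrift e_δ) g₂ =
K(g₁) D(e_δ) K(g₂) D(e_δ) K(g₁)` of `SplittingWords`, exact on the `SU(N)` rung by `Omf2ProposalLaws` §0 for ANY kicks).
The general-coordinates twin of `SU2Omf2EnergyError`; the OMF2 twin of `SUNLeapfrogEnergyError` §3.  NEW WORK of the cell
over `SUNExpDriftWork` (the drift `sunExpDrift ι hι δ` moves a configuration by `≤ N²C_ι|δ|‖p‖` in the matrix sup norm;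
first-order Taylor with explicit remainder `½N²C_ιβ|δ|K‖p‖Σ‖p_l‖` for a force field represented through a pairing `B`),
row 9's `SUNMultiStepLeapfrogHMC` (`sunExpDrift`), `SplittingWords` (`omf2Word`, `palindromicWord`, `kick`, `drift`,
`mulDrift`); nothing is cited as a fact; no number.  SETTING: coordinates `ι` with `‖ι x‖ ≤ C_ι‖x‖`; ANY action
`S : (L → SU(N)) → ℝ`; a force field `D` REPRESENTING the differential of `a ↦ S(e_δ(a)·W)` at `0` along the HALF-step
drift `e_δ` through a symmetric pairing `B` (`|B(x,y)| ≤ β‖x‖‖y‖`), `‖D(W)_l‖ ≤ D_max`, `‖D(W) − D(W')‖ ≤ K‖coeConfig W − coeConfig W'‖`;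
kinetic term `κΣ_l B(p_l,p_l)`; the kicks are the CONSISTENT ones: `g₁ = −(λ/κ)D`, `g₂ = −((1−2λ)/κ)D` (fractions
`λ, 1−2λ, λ` of the full-step kick `−D/κ`).

* `sunOmf2Step_apply` — the word read off: `(q, p) ↦ (q₂, p₃)` with `p₁ = p + g₁ q`, `q₁ = e_δ(p₁)·q`, `p₂ = p₁ + g₂ q₁`,
  `q₂ = e_δ(p₂)·q₁`, `p₃ = p₂ + g₁ q₂`;
* `pairing_kick_increment` — `κ(B(x − (c/κ)v, x − (c/κ)v) − B(x,x)) = −c(B(x, v) + B(x − (c/κ)v, v))`;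
* **`sunOmf2_energy_identity`** — `H(q₂,p₃) − H(q,p) = (1−2λ)ΣB(p₁, D q − D q₁) + 2λΣB(p₂, D q₁ − D q₂) +
  (λ²/κ)Σ(B(D q₂, D q₂) − B(D q, D q)) + [S q₁ − S q − ΣB(D q, p₁)] + [S q₂ − S q₁ − ΣB(D q₁, p₂)]` EXACTLY — the first-order
  terms cancel because the kick fractions sum to the drift fractions;
* `norm_sunFracKick_apply_le` / `norm_sunFracKick_le` (`‖−(c/κ)D‖ ≤ |c|D_max/κ`);
* **`abs_sunOmf2_energy_error_le`** — with `A = N²C_ι`, `γ = (|λ| + |1−2λ|)D_max/κ`: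
  `|ΔH| ≤ βK·A|δ|·(‖p‖ + γ)·((|1−2λ| + 2|λ| + 1)·(Σ_l‖p_l‖ + |L|γ) + 4λ²|L|D_max/κ)` — SECOND ORDER in the step
  (`K, D_max = O(δ)` for represented exact forces), every constant explicit (`A = 8`, `β = 1` is the `SU(2)` file's bound).

NOT CLAIMED: the `n`-step trajectory and the proposal (`SUNOmf2TrajectoryEnergyError`); OMF4; optimal constants; floating
point; any number.
-/

noncomputable section

namespace Summit.Ventures.LatticeQCDFlow.Exactness

open Set Function NormedSpace
open scoped Matrix Matrix.Norms.Operator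

set_option backward.isDefEq.respectTransparency false

variable {n : Type*} [Fintype n] [DecidableEq n]
variable {E : Type*} [NormedAddCommGroup E] [NormedSpace ℝ E]
variable (ι : E →ₗ[ℝ] Matrix n n ℂ) (hι : ∀ a, (ι a)ᴴ = -ι a ∧ (ι a).trace = 0)
variable {L : Type*}

/-- **The OMF2 word `omf2Word g₁ (mulDrift (sunExpDrift ι hι δ)) g₂` is kick–drift–kick–drift–kick, read off**:
`(q, p) ↦ (q₂, p₂ + g₁ q₂)` with `p₁ = p + g₁ q`, `q₁ = e_δ(p₁)·q`, `p₂ = p₁ + g₂ q₁`, `q₂ = e_δ(p₂)·q₁`. -/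
theorem sunOmf2Step_apply (g₁ g₂ : (L → Matrix.specialUnitaryGroup n ℂ) → L → E) (δ : ℝ)
    (q : L → Matrix.specialUnitaryGroup n ℂ) (p : L → E) :
    omf2Word g₁ (mulDrift (sunExpDrift ι hι δ)) g₂ (q, p) =
      (sunExpDrift ι hι δ ((p + g₁ q) + g₂ (sunExpDrift ι hι δ (p + g₁ q) * q)) * (sunExpDrift ι hι δ (p + g₁ q) * q),
        ((p + g₁ q) + g₂ (sunExpDrift ι hι δ (p + g₁ q) * q)) +
          g₁ (sunExpDrift ι hι δ ((p + g₁ q) + g₂ (sunExpDrift ι hι δ (p + g₁ q) * q)) * (sunExpDrift ι hι δ (p + g₁ q) * q))) := by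
  simp only [omf2Word, palindromicWord, List.prod_cons, List.prod_nil, mul_one, List.reverse_cons, List.reverse_nil,
    List.nil_append, List.cons_append, Equiv.Perm.mul_apply]
  rfl

variable (B : E →ₗ[ℝ] E →ₗ[ℝ] ℝ)

omit [Fintype n] [DecidableEq n] in
/-- The kinetic increment of a kick by the fraction `c` of the consistent full-step kick, for a symmetric pairing:
`κ(B(x − (c/κ)v, x − (c/κ)v) − B(x,x)) = −c(B(x, v) + B(x − (c/κ)v, v))`. -/
theorem pairing_kick_increment (hBs : ∀ x y : E, B x y = B y x) (κ c : ℝ) (hκ : κ ≠ 0) (x v : E) :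
    κ * (B (x + (-(c / κ)) • v) (x + (-(c / κ)) • v) - B x x) = -c * (B x v + B (x + (-(c / κ)) • v) v) := by
  simp only [map_add, map_smul, LinearMap.add_apply, LinearMap.smul_apply, smul_eq_mul]
  rw [hBs v x]
  field_simp
  ring

variable [Fintype L]

/-- **THE OMF2 ENERGY IDENTITY FOR THE CONSISTENT KICKS `g₁ = −(λ/κ)D`, `g₂ = −((1−2λ)/κ)D`** (two drifts `e_δ`,
`H = S + κΣ_l B(p_l,p_l)`, `B` symmetric): with `p₁ = p + g₁ q`, `q₁ = e_δ(p₁)·q`, `p₂ = p₁ + g₂ q₁`, `q₂ = e_δ(p₂)·q₁`,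
`p₃ = p₂ + g₁ q₂`,
`H(q₂,p₃) − H(q,p) = (1−2λ)ΣB(p₁, D q − D q₁) + 2λΣB(p₂, D q₁ − D q₂) + (λ²/κ)Σ(B(D q₂,D q₂) − B(D q,D q))`
`  + [S q₁ − S q − ΣB(D q, p₁)] + [S q₂ − S q₁ − ΣB(D q₁, p₂)]` — every term second order. -/
theorem sunOmf2_energy_identity (S : (L → Matrix.specialUnitaryGroup n ℂ) → ℝ) (δ κ lam : ℝ) (hκ : κ ≠ 0)
    (hBs : ∀ x y : E, B x y = B y x) (D g₁ g₂ : (L → Matrix.specialUnitaryGroup n ℂ) → L → E)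
    (hg₁ : ∀ W l, g₁ W l = -(lam / κ) • D W l) (hg₂ : ∀ W l, g₂ W l = -((1 - 2 * lam) / κ) • D W l)
    (q : L → Matrix.specialUnitaryGroup n ℂ) (p : L → E) :
    let p₁ := p + g₁ q
    let q₁ := sunExpDrift ι hι δ p₁ * q
    let p₂ := p₁ + g₂ q₁
    let q₂ := sunExpDrift ι hι δ p₂ * q₁
    let p₃ := p₂ + g₁ q₂
    (S q₂ + κ * ∑ l, B (p₃ l) (p₃ l)) - (S q + κ * ∑ l, B (p l) (p l)) =
      (1 - 2 * lam) * ∑ l, B (p₁ l) (D q l - D q₁ l) + 2 * lam * ∑ l, B (p₂ l) (D q₁ l - D q₂ l) +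
        lam ^ 2 / κ * ∑ l, (B (D q₂ l) (D q₂ l) - B (D q l) (D q l)) +
        ((S q₁ - S q - ∑ l, B (D q l) (p₁ l)) + (S q₂ - S q₁ - ∑ l, B (D q₁ l) (p₂ l))) := by
  intro p₁ q₁ p₂ q₂ p₃
  -- the three kinetic increments, link by link
  have e1 : ∀ l, p₁ l = p l + (-(lam / κ)) • D q l := fun l => by show p l + g₁ q l = _; rw [hg₁]
  have e2 : ∀ l, p₂ l = p₁ l + (-((1 - 2 * lam) / κ)) • D q₁ l := fun l => by show p₁ l + g₂ q₁ l = _; rw [hg₂]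
  have e3 : ∀ l, p₃ l = p₂ l + (-(lam / κ)) • D q₂ l := fun l => by show p₂ l + g₁ q₂ l = _; rw [hg₁]
  have K1 : ∀ l, κ * (B (p₁ l) (p₁ l) - B (p l) (p l)) = -lam * (B (p l) (D q l) + B (p₁ l) (D q l)) := fun l => by
    rw [e1]; exact pairing_kick_increment B hBs κ lam hκ (p l) (D q l)
  have K2 : ∀ l, κ * (B (p₂ l) (p₂ l) - B (p₁ l) (p₁ l)) = -(1 - 2 * lam) * (B (p₁ l) (D q₁ l) + B (p₂ l) (D q₁ l)) := fun l => by
    rw [e2]; exact pairing_kick_increment B hBs κ (1 - 2 * lam) hκ (p₁ l) (D q₁ l)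
  have K3 : ∀ l, κ * (B (p₃ l) (p₃ l) - B (p₂ l) (p₂ l)) = -lam * (B (p₂ l) (D q₂ l) + B (p₃ l) (D q₂ l)) := fun l => by
    rw [e3]; exact pairing_kick_increment B hBs κ lam hκ (p₂ l) (D q₂ l)
  -- the outer momenta read through the inner ones
  have hP0 : ∀ l, B (p l) (D q l) = B (p₁ l) (D q l) + lam / κ * B (D q l) (D q l) := by
    intro l
    have e : p l = p₁ l + (lam / κ) • D q l := by
      rw [e1, add_assoc, ← add_smul, neg_add_cancel, zero_smul, add_zero]
    rw [e, map_add, map_smul, LinearMap.add_apply, LinearMap.smul_apply, smul_eq_mul]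
  have hP3 : ∀ l, B (p₃ l) (D q₂ l) = B (p₂ l) (D q₂ l) - lam / κ * B (D q₂ l) (D q₂ l) := by
    intro l
    rw [e3, map_add, map_smul, LinearMap.add_apply, LinearMap.smul_apply, smul_eq_mul]
    ring
  have key : ∀ l, κ * (B (p₃ l) (p₃ l) - B (p l) (p l)) =
      (1 - 2 * lam) * B (p₁ l) (D q l - D q₁ l) + 2 * lam * B (p₂ l) (D q₁ l - D q₂ l) +
        lam ^ 2 / κ * (B (D q₂ l) (D q₂ l) - B (D q l) (D q l)) - B (D q l) (p₁ l) - B (D q₁ l) (p₂ l) := by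
    intro l
    rw [map_sub, map_sub, hBs (D q l) (p₁ l), hBs (D q₁ l) (p₂ l)]
    have hk : κ * (B (p₃ l) (p₃ l) - B (p l) (p l)) =
        κ * (B (p₁ l) (p₁ l) - B (p l) (p l)) + κ * (B (p₂ l) (p₂ l) - B (p₁ l) (p₁ l)) + κ * (B (p₃ l) (p₃ l) - B (p₂ l) (p₂ l)) := by
      ring
    rw [hk, K1, K2, K3, hP0, hP3]
    field_simp
    ring
  have hsum : κ * ∑ l, (B (p₃ l) (p₃ l) - B (p l) (p l)) =
      (1 - 2 * lam) * ∑ l, B (p₁ l) (D q l - D q₁ l) + 2 * lam * ∑ l, B (p₂ l) (D q₁ l - D q₂ l) +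
        lam ^ 2 / κ * ∑ l, (B (D q₂ l) (D q₂ l) - B (D q l) (D q l)) - ∑ l, B (D q l) (p₁ l) - ∑ l, B (D q₁ l) (p₂ l) := by
    rw [Finset.mul_sum, Finset.mul_sum, Finset.mul_sum, Finset.mul_sum, ← Finset.sum_add_distrib, ← Finset.sum_add_distrib,
      ← Finset.sum_sub_distrib, ← Finset.sum_sub_distrib]
    exact Finset.sum_congr rfl fun l _ => key l
  have hsplit : κ * ∑ l, B (p₃ l) (p₃ l) - κ * ∑ l, B (p l) (p l) = κ * ∑ l, (B (p₃ l) (p₃ l) - B (p l) (p l)) := by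
    rw [Finset.sum_sub_distrib, mul_sub]
  linarith [hsum, hsplit]

omit [Fintype L] in
/-- The fractional kick `−(c/κ)D` is bounded by `|c|·D_max/κ` linkwise (`κ > 0`). -/
theorem norm_sunFracKick_apply_le (κ c : ℝ) (hκ : 0 < κ) (D g : (L → Matrix.specialUnitaryGroup n ℂ) → L → E)
    (hg : ∀ W l, g W l = -(c / κ) • D W l) {Dmax : ℝ}
    (hDb : ∀ (W : L → Matrix.specialUnitaryGroup n ℂ) (l : L), ‖D W l‖ ≤ Dmax)
    (W : L → Matrix.specialUnitaryGroup n ℂ) (l : L) : ‖g W l‖ ≤ |c| * (Dmax / κ) := by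
  rw [hg W l, norm_smul, norm_neg, Real.norm_eq_abs, abs_div, abs_of_pos hκ]
  calc |c| / κ * ‖D W l‖ ≤ |c| / κ * Dmax := by gcongr; exact hDb W l
    _ = |c| * (Dmax / κ) := by ring

/-- The fractional kick is bounded by `|c|·D_max/κ` in the sup norm. -/
theorem norm_sunFracKick_le (κ c : ℝ) (hκ : 0 < κ) (D g : (L → Matrix.specialUnitaryGroup n ℂ) → L → E)
    (hg : ∀ W l, g W l = -(c / κ) • D W l) {Dmax : ℝ} (hD0 : 0 ≤ Dmax)
    (hDb : ∀ (W : L → Matrix.specialUnitaryGroup n ℂ) (l : L), ‖D W l‖ ≤ Dmax)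
    (W : L → Matrix.specialUnitaryGroup n ℂ) : ‖g W‖ ≤ |c| * (Dmax / κ) :=
  (pi_norm_le_iff_of_nonneg (by positivity)).2 fun l => norm_sunFracKick_apply_le κ c hκ D g hg hDb W l

set_option maxHeartbeats 400000 in
/-- **THE ENERGY ERROR OF ONE OMF2 STEP IS SECOND ORDER, EXPLICITLY.**  If `a ↦ S(e_δ(a)·W)` is differentiable at `0`
for every `W` with differential `Σ_l B(D(W)_l, ·_l)` (`B` symmetric, `|B(x,y)| ≤ β‖x‖‖y‖`), `‖D(W)_l‖ ≤ D_max`,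
`‖D(W) − D(W')‖ ≤ K‖coeConfig W − coeConfig W'‖` and `‖ι x‖ ≤ C_ι‖x‖`, then for the consistent kicks `g₁ = −(λ/κ)D`,
`g₂ = −((1−2λ)/κ)D` (`κ > 0`), with `A = N²C_ι`, `γ = (|λ| + |1−2λ|)·D_max/κ`, `P = ‖p‖ + γ`, `Σ = Σ_l‖p_l‖ + |L|γ`:
`|H(q₂,p₃) − H(q,p)| ≤ βK·A|δ|·P·((|1−2λ| + 2|λ| + 1)·Σ + 4λ²|L|D_max/κ)`. -/
theorem abs_sunOmf2_energy_error_le {Cι : ℝ} (hC0 : 0 ≤ Cι) (hCι : ∀ x : E, ‖ι x‖ ≤ Cι * ‖x‖)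
    (S : (L → Matrix.specialUnitaryGroup n ℂ) → ℝ) (δ κ lam : ℝ) (hκ : 0 < κ)
    (hd : ∀ W : L → Matrix.specialUnitaryGroup n ℂ, DifferentiableAt ℝ (fun a : L → E => S (sunExpDrift ι hι δ a * W)) 0)
    (hBs : ∀ x y : E, B x y = B y x) {β : ℝ} (hβ0 : 0 ≤ β) (hBβ : ∀ x y : E, |B x y| ≤ β * ‖x‖ * ‖y‖)
    (D g₁ g₂ : (L → Matrix.specialUnitaryGroup n ℂ) → L → E)
    (hD : ∀ (W : L → Matrix.specialUnitaryGroup n ℂ) (v : L → E),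
      fderiv ℝ (fun a : L → E => S (sunExpDrift ι hι δ a * W)) 0 v = ∑ l, B (D W l) (v l))
    {Dmax K : ℝ} (hD0 : 0 ≤ Dmax) (hK0 : 0 ≤ K)
    (hDb : ∀ (W : L → Matrix.specialUnitaryGroup n ℂ) (l : L), ‖D W l‖ ≤ Dmax)
    (hDK : ∀ W W' : L → Matrix.specialUnitaryGroup n ℂ, ‖D W - D W'‖ ≤ K * ‖coeConfig W - coeConfig W'‖)
    (hg₁ : ∀ W l, g₁ W l = -(lam / κ) • D W l) (hg₂ : ∀ W l, g₂ W l = -((1 - 2 * lam) / κ) • D W l)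
    (q : L → Matrix.specialUnitaryGroup n ℂ) (p : L → E) :
    |(S (sunExpDrift ι hι δ ((p + g₁ q) + g₂ (sunExpDrift ι hι δ (p + g₁ q) * q)) * (sunExpDrift ι hι δ (p + g₁ q) * q)) +
        κ * ∑ l, B ((((p + g₁ q) + g₂ (sunExpDrift ι hι δ (p + g₁ q) * q)) +
            g₁ (sunExpDrift ι hι δ ((p + g₁ q) + g₂ (sunExpDrift ι hι δ (p + g₁ q) * q)) * (sunExpDrift ι hι δ (p + g₁ q) * q))) l)
          ((((p + g₁ q) + g₂ (sunExpDrift ι hι δ (p + g₁ q) * q)) +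
            g₁ (sunExpDrift ι hι δ ((p + g₁ q) + g₂ (sunExpDrift ι hι δ (p + g₁ q) * q)) * (sunExpDrift ι hι δ (p + g₁ q) * q))) l)) -
      (S q + κ * ∑ l, B (p l) (p l))| ≤
      β * K * ((Fintype.card n : ℝ) ^ 2 * Cι) * |δ| * (‖p‖ + (|lam| + |1 - 2 * lam|) * (Dmax / κ)) *
        ((|1 - 2 * lam| + 2 * |lam| + 1) * (∑ l, ‖p l‖ + Fintype.card L * ((|lam| + |1 - 2 * lam|) * (Dmax / κ))) +
          4 * lam ^ 2 * (Fintype.card L * Dmax / κ)) := by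
  have hid := sunOmf2_energy_identity ι hι B S δ κ lam hκ.ne' hBs D g₁ g₂ hg₁ hg₂ q p
  simp only at hid
  rw [hid]
  set p₁ := p + g₁ q with hp₁
  set q₁ := sunExpDrift ι hι δ p₁ * q with hq₁
  set p₂ := p₁ + g₂ q₁ with hp₂
  set q₂ := sunExpDrift ι hι δ p₂ * q₁ with hq₂
  set A : ℝ := (Fintype.card n : ℝ) ^ 2 * Cι with hA
  set γ : ℝ := (|lam| + |1 - 2 * lam|) * (Dmax / κ) with hγ
  set P : ℝ := ‖p‖ + γ with hP
  set Sg : ℝ := ∑ l, ‖p l‖ + Fintype.card L * γ with hSgdef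
  have hA0 : 0 ≤ A := by rw [hA]; positivity
  have hγ0 : 0 ≤ γ := by rw [hγ]; positivity
  -- kicks are small
  have hk₁ : ∀ W, ‖g₁ W‖ ≤ |lam| * (Dmax / κ) := fun W => norm_sunFracKick_le κ lam hκ D g₁ hg₁ hD0 hDb W
  have hk₂ : ∀ W, ‖g₂ W‖ ≤ |1 - 2 * lam| * (Dmax / κ) := fun W => norm_sunFracKick_le κ (1 - 2 * lam) hκ D g₂ hg₂ hD0 hDb W
  have hk₁l : ∀ W l, ‖g₁ W l‖ ≤ |lam| * (Dmax / κ) := fun W l => norm_sunFracKick_apply_le κ lam hκ D g₁ hg₁ hDb W l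
  have hk₂l : ∀ W l, ‖g₂ W l‖ ≤ |1 - 2 * lam| * (Dmax / κ) := fun W l => norm_sunFracKick_apply_le κ (1 - 2 * lam) hκ D g₂ hg₂ hDb W l
  -- the momenta along the step are bounded by P, their link sums by Sg
  have hP₁ : ‖p₁‖ ≤ P := by
    rw [hP, hp₁, hγ]
    calc ‖p + g₁ q‖ ≤ ‖p‖ + ‖g₁ q‖ := norm_add_le _ _
      _ ≤ ‖p‖ + |lam| * (Dmax / κ) := add_le_add le_rfl (hk₁ q)
      _ ≤ ‖p‖ + (|lam| + |1 - 2 * lam|) * (Dmax / κ) := by nlinarith [abs_nonneg (1 - 2 * lam), div_nonneg hD0 hκ.le]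
  have hP₂ : ‖p₂‖ ≤ P := by
    rw [hP, hp₂, hp₁, hγ]
    calc ‖p + g₁ q + g₂ q₁‖ ≤ ‖p‖ + ‖g₁ q‖ + ‖g₂ q₁‖ := (norm_add_le _ _).trans (add_le_add (norm_add_le _ _) le_rfl)
      _ ≤ ‖p‖ + |lam| * (Dmax / κ) + |1 - 2 * lam| * (Dmax / κ) := add_le_add (add_le_add le_rfl (hk₁ q)) (hk₂ q₁)
      _ = ‖p‖ + (|lam| + |1 - 2 * lam|) * (Dmax / κ) := by ring
  have hS1 : ∑ l, ‖p₁ l‖ ≤ Sg := by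
    rw [hSgdef, hp₁, hγ]
    calc ∑ l, ‖(p + g₁ q) l‖ ≤ ∑ l, (‖p l‖ + |lam| * (Dmax / κ)) :=
          Finset.sum_le_sum fun l _ => by rw [Pi.add_apply]; exact (norm_add_le _ _).trans (add_le_add le_rfl (hk₁l q l))
      _ = ∑ l, ‖p l‖ + Fintype.card L * (|lam| * (Dmax / κ)) := by
          rw [Finset.sum_add_distrib, Finset.sum_const, Finset.card_univ, nsmul_eq_mul]
      _ ≤ ∑ l, ‖p l‖ + Fintype.card L * ((|lam| + |1 - 2 * lam|) * (Dmax / κ)) := by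
          gcongr; nlinarith [abs_nonneg (1 - 2 * lam), div_nonneg hD0 hκ.le]
  have hS2 : ∑ l, ‖p₂ l‖ ≤ Sg := by
    rw [hSgdef, hp₂, hp₁, hγ]
    calc ∑ l, ‖(p + g₁ q + g₂ q₁) l‖ ≤ ∑ l, (‖p l‖ + |lam| * (Dmax / κ) + |1 - 2 * lam| * (Dmax / κ)) :=
          Finset.sum_le_sum fun l _ => by
            rw [Pi.add_apply, Pi.add_apply]
            exact (norm_add_le _ _).trans (add_le_add ((norm_add_le _ _).trans (add_le_add le_rfl (hk₁l q l))) (hk₂l q₁ l))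
      _ = ∑ l, ‖p l‖ + Fintype.card L * ((|lam| + |1 - 2 * lam|) * (Dmax / κ)) := by
          rw [Finset.sum_add_distrib, Finset.sum_add_distrib, Finset.sum_const, Finset.sum_const, Finset.card_univ, nsmul_eq_mul,
            nsmul_eq_mul]; ring
  have hP0 : 0 ≤ P := by rw [hP]; positivity
  have hSg0 : 0 ≤ Sg := by rw [hSgdef]; positivity
  -- the two drifts move the field by at most A|δ|‖p₁‖ and A|δ|‖p₂‖
  have hdist₁ : ‖coeConfig q - coeConfig q₁‖ ≤ A * |δ| * ‖p₁‖ := by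
    have h := norm_coeConfig_sunExpDrift_sub_le ι hι hC0 hCι δ q p₁ 0 1
    rw [zero_smul, sunExpDrift_zero, one_mul, one_smul, zero_sub, abs_neg, abs_one, mul_one] at h
    rw [hA]; exact h
  have hdist₂ : ‖coeConfig q₁ - coeConfig q₂‖ ≤ A * |δ| * ‖p₂‖ := by
    have h := norm_coeConfig_sunExpDrift_sub_le ι hι hC0 hCι δ q₁ p₂ 0 1
    rw [zero_smul, sunExpDrift_zero, one_mul, one_smul, zero_sub, abs_neg, abs_one, mul_one] at h
    rw [hA]; exact h
  have hD01 : ∀ l, ‖D q l - D q₁ l‖ ≤ K * (A * |δ| * P) := fun l =>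
    ((norm_le_pi_norm (D q - D q₁) l).trans (hDK q q₁)).trans
      (mul_le_mul_of_nonneg_left (hdist₁.trans (by gcongr)) hK0)
  have hD12 : ∀ l, ‖D q₁ l - D q₂ l‖ ≤ K * (A * |δ| * P) := fun l =>
    ((norm_le_pi_norm (D q₁ - D q₂) l).trans (hDK q₁ q₂)).trans
      (mul_le_mul_of_nonneg_left (hdist₂.trans (by gcongr)) hK0)
  have hD02 : ∀ l, ‖D q₂ l - D q l‖ ≤ K * (2 * A * |δ| * P) := by
    intro l
    calc ‖D q₂ l - D q l‖ ≤ ‖D q₂ l - D q₁ l‖ + ‖D q₁ l - D q l‖ := norm_sub_le_norm_sub_add_norm_sub _ _ _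
      _ ≤ K * (A * |δ| * P) + K * (A * |δ| * P) := by
          have e1 : ‖D q₂ l - D q₁ l‖ = ‖D q₁ l - D q₂ l‖ := norm_sub_rev (D q₂ l) (D q₁ l)
          have e2 : ‖D q₁ l - D q l‖ = ‖D q l - D q₁ l‖ := norm_sub_rev (D q₁ l) (D q l)
          rw [e1, e2]; exact add_le_add (hD12 l) (hD01 l)
      _ = K * (2 * A * |δ| * P) := by ring
  -- term 1
  have h1 : |(1 - 2 * lam) * ∑ l, B (p₁ l) (D q l - D q₁ l)| ≤ |1 - 2 * lam| * (β * K * A * |δ| * P * Sg) := by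
    rw [abs_mul]
    refine mul_le_mul_of_nonneg_left ?_ (abs_nonneg _)
    refine (Finset.abs_sum_le_sum_abs _ _).trans ?_
    calc ∑ l, |B (p₁ l) (D q l - D q₁ l)| ≤ ∑ l, β * ‖p₁ l‖ * (K * (A * |δ| * P)) :=
          Finset.sum_le_sum fun l _ => (hBβ _ _).trans (mul_le_mul_of_nonneg_left (hD01 l) (by positivity))
      _ = β * (∑ l, ‖p₁ l‖) * (K * (A * |δ| * P)) := by rw [Finset.mul_sum, Finset.sum_mul]
      _ ≤ β * Sg * (K * (A * |δ| * P)) := by gcongr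
      _ = β * K * A * |δ| * P * Sg := by ring
  -- term 2
  have h2 : |2 * lam * ∑ l, B (p₂ l) (D q₁ l - D q₂ l)| ≤ 2 * |lam| * (β * K * A * |δ| * P * Sg) := by
    rw [abs_mul, abs_mul, abs_two]
    refine mul_le_mul_of_nonneg_left ?_ (by positivity)
    refine (Finset.abs_sum_le_sum_abs _ _).trans ?_
    calc ∑ l, |B (p₂ l) (D q₁ l - D q₂ l)| ≤ ∑ l, β * ‖p₂ l‖ * (K * (A * |δ| * P)) :=
          Finset.sum_le_sum fun l _ => (hBβ _ _).trans (mul_le_mul_of_nonneg_left (hD12 l) (by positivity))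
      _ = β * (∑ l, ‖p₂ l‖) * (K * (A * |δ| * P)) := by rw [Finset.mul_sum, Finset.sum_mul]
      _ ≤ β * Sg * (K * (A * |δ| * P)) := by gcongr
      _ = β * K * A * |δ| * P * Sg := by ring
  -- term 3
  have h3 : |lam ^ 2 / κ * ∑ l, (B (D q₂ l) (D q₂ l) - B (D q l) (D q l))| ≤
      lam ^ 2 / κ * (Fintype.card L * (β * (K * (2 * A * |δ| * P)) * (2 * Dmax))) := by
    rw [abs_mul, abs_of_nonneg (by positivity : (0 : ℝ) ≤ lam ^ 2 / κ)]
    refine mul_le_mul_of_nonneg_left ?_ (by positivity)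
    refine (Finset.abs_sum_le_sum_abs _ _).trans ?_
    calc ∑ l, |B (D q₂ l) (D q₂ l) - B (D q l) (D q l)| ≤ ∑ _l : L, β * (K * (2 * A * |δ| * P)) * (2 * Dmax) := by
          refine Finset.sum_le_sum fun l _ => ?_
          have hsq : B (D q₂ l) (D q₂ l) - B (D q l) (D q l) = B (D q₂ l - D q l) (D q₂ l + D q l) := by
            rw [LinearMap.map_sub₂, map_add, map_add, hBs (D q l) (D q₂ l)]; ring
          rw [hsq]
          have hs : ‖D q₂ l + D q l‖ ≤ 2 * Dmax := by
            calc ‖D q₂ l + D q l‖ ≤ ‖D q₂ l‖ + ‖D q l‖ := norm_add_le _ _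
              _ ≤ Dmax + Dmax := add_le_add (hDb q₂ l) (hDb q l)
              _ = 2 * Dmax := by ring
          calc |B (D q₂ l - D q l) (D q₂ l + D q l)| ≤ β * ‖D q₂ l - D q l‖ * ‖D q₂ l + D q l‖ := hBβ _ _
            _ ≤ β * (K * (2 * A * |δ| * P)) * (2 * Dmax) := by gcongr; exact hD02 l
      _ = Fintype.card L * (β * (K * (2 * A * |δ| * P)) * (2 * Dmax)) := by
          rw [Finset.sum_const, Finset.card_univ, nsmul_eq_mul]
  -- the two Taylor remainders
  have h4 : |S q₁ - S q - ∑ l, B (D q l) (p₁ l)| ≤ A * β * |δ| * K * P * Sg / 2 := by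
    have h := abs_action_sunExpDrift_sub_linear_le ι hι B hC0 hCι S δ hd D hD hβ0 hBβ hK0 hDK q p₁
    have hm : (Fintype.card n : ℝ) ^ 2 * Cι * β * |δ| * K * ‖p₁‖ * (∑ l, ‖p₁ l‖) / 2 ≤ A * β * |δ| * K * P * Sg / 2 := by
      rw [hA]; gcongr
    exact h.trans hm
  have h5 : |S q₂ - S q₁ - ∑ l, B (D q₁ l) (p₂ l)| ≤ A * β * |δ| * K * P * Sg / 2 := by
    have h := abs_action_sunExpDrift_sub_linear_le ι hι B hC0 hCι S δ hd D hD hβ0 hBβ hK0 hDK q₁ p₂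
    have hm : (Fintype.card n : ℝ) ^ 2 * Cι * β * |δ| * K * ‖p₂‖ * (∑ l, ‖p₂ l‖) / 2 ≤ A * β * |δ| * K * P * Sg / 2 := by
      rw [hA]; gcongr
    exact h.trans hm
  -- assemble
  have hsum := abs_add_le
    ((1 - 2 * lam) * ∑ l, B (p₁ l) (D q l - D q₁ l) + 2 * lam * ∑ l, B (p₂ l) (D q₁ l - D q₂ l) +
      lam ^ 2 / κ * ∑ l, (B (D q₂ l) (D q₂ l) - B (D q l) (D q l)))
    ((S q₁ - S q - ∑ l, B (D q l) (p₁ l)) + (S q₂ - S q₁ - ∑ l, B (D q₁ l) (p₂ l)))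
  have hA3 := abs_add_three ((1 - 2 * lam) * ∑ l, B (p₁ l) (D q l - D q₁ l)) (2 * lam * ∑ l, B (p₂ l) (D q₁ l - D q₂ l))
    (lam ^ 2 / κ * ∑ l, (B (D q₂ l) (D q₂ l) - B (D q l) (D q l)))
  have hB2 := abs_add_le (S q₁ - S q - ∑ l, B (D q l) (p₁ l)) (S q₂ - S q₁ - ∑ l, B (D q₁ l) (p₂ l))
  have htot : (|1 - 2 * lam| * (β * K * A * |δ| * P * Sg)) + 2 * |lam| * (β * K * A * |δ| * P * Sg) +
      lam ^ 2 / κ * (Fintype.card L * (β * (K * (2 * A * |δ| * P)) * (2 * Dmax))) + (A * β * |δ| * K * P * Sg / 2 + A * β * |δ| * K * P * Sg / 2) =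
      β * K * A * |δ| * P * ((|1 - 2 * lam| + 2 * |lam| + 1) * Sg + 4 * lam ^ 2 * (Fintype.card L * Dmax / κ)) := by
    ring
  exact hsum.trans ((add_le_add hA3 hB2).trans ((add_le_add (add_le_add (add_le_add h1 h2) h3) (add_le_add h4 h5)).trans htot.le))

end Summit.Ventures.LatticeQCDFlow.Exactness
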